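import Mathlib
import HarnessLib
import Summits.NavierStokesRegularity.NavierStokesRegularity.Theses.ExtremalTypeIConstant
import Summits.NavierStokesRegularity.NavierStokesRegularity.Theorems.ExtremalTypeIConstantExtremalSpiralSymmetryStubClosedSubgroupCharacter
import Summits.NavierStokesRegularity.NavierStokesRegularity.Theorems.ExtremalTypeIConstantExtremalSpiralSymmetryStubGeneratorOfFamily
import Summits.NavierStokesRegularity.NavierStokesRegularity.Theorems.ExtremalTypeIConstantExtremalSpiralSymmetryStubStabiliserClosedSubgroup
import Summits.NavierStokesRegularity.NavierStokesRegularity.Theorems.ExtremalTypeIConstantExtremalSpiralSymmetryStubSymmetryFamily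
import Summits.NavierStokesRegularity.NavierStokesRegularity.Theorems.ExtremalTypeIConstantExtremalSpiralSymmetryTargetOfRecurrence

/-!
# Crux `ExtremalSpiralSymmetry` (stmt-NavierStokesRegularity-8215), line `registered` — structural consequence:
# the crux follows from the LOCAL SCALING STABILISER of extremals alone (Conjecture M as "isolated modulo
# rigid motions and time shifts"), by the landed generator machinery

Support file (theorems only, `--supports stmt-NavierStokesRegularity-8215`; no definitions, no named facts). Lead c2.

The line's generator half is entirely landed (c1: `stub_closedSubgroupCharacter` p147108, `stub_generatorOfFamily`
p147157, `stub_stabiliserClosedSubgroup` p149187, `stub_symmetryFamily` p149196) and so is the pinning lemma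
(`timeShift_pinned`, `…TargetOfRecurrence.lean`). This file packages them into the importable statement

* `extremalSpiralSymmetry_of_localScalingStabiliser` — IF every extremal pair `(C, u)` has scaling symmetries modulo
  the class-preserving semigroup for all factors near `1` (`∃ δ₀ > 0, ∀ c, |c − 1| < δ₀ → ∃ δ ≥ 0, b, R` with
  `c u(c²t, cx) = R u(t − δ, R⁻¹(x − b))` on `t < 0`) — which is exactly what the card's Conjecture M "minimisers are
  ISOLATED modulo translations, rotations (and time shifts)" yields, since `c ↦ S_c u` is a continuous curve of
  minimisers through `u` — THEN `ExtremalSpiralSymmetry` holds: pinning makes every `δ = 0`, the rigid stabiliser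
  covers all factors near `1`, and the closed-subgroup/character/chain-rule machinery produces the skew generator.

So the crux has two kernel-checked sufficient routes on the ledger: (i) this one (local stabiliser = isolatedness, for
EVERY extremal), and (ii) `stub_scalingRecurrence ∧ stmt-8561` (`…TargetOfRecurrence.lean`, vacuous: no extremal
survives). CONDITIONAL on the displayed hypothesis (never asserted).
-/

noncomputable section

-- the summit and its single sub-problem share the name (CONVENTIONS §1), as in every Theorems file
set_option linter.dupNamespace false

open Set MeasureTheory Filter Topology
open Literature.Analysis.FluidPDE

namespace Summit.NavierStokesRegularity.NavierStokesRegularity.Theorems.ExtremalSpiralSymmetry.Registered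

/-- **The spiral generator from the local rigid stabiliser** (the skeleton's `spiralGenerator_of_stubs`, assembled
from the four landed generator stubs): a field differentiable on the open slab whose parabolic rescalings `S_c u`, for
all factors `c` near `1`, are rigid motions of `u` on `t < 0` has an infinitesimal spiral-scaling symmetry with skew
rotation part. [folklore] -/
theorem spiralGenerator_of_localRigidStabiliser
    (u : ℝ → EuclideanSpace ℝ (Fin 3) → EuclideanSpace ℝ (Fin 3))
    (hdiff : DifferentiableOn ℝ (Function.uncurry u) (Set.Iio 0 ×ˢ Set.univ))
    (hloc : ∃ δ₀ : ℝ, 0 < δ₀ ∧ ∀ c : ℝ, |c - 1| < δ₀ →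
      ∃ (b : EuclideanSpace ℝ (Fin 3)) (R : EuclideanSpace ℝ (Fin 3) ≃ₗᵢ[ℝ] EuclideanSpace ℝ (Fin 3)),
        ∀ t < 0, ∀ x, c • u (c ^ 2 * t) (c • x) = R (u t (R.symm (x - b)))) :
    ∃ (a : EuclideanSpace ℝ (Fin 3)) (A : EuclideanSpace ℝ (Fin 3) →L[ℝ] EuclideanSpace ℝ (Fin 3)),
      (∀ x, inner ℝ (A x) x = 0) ∧
      ∀ t < 0, ∀ x, fderiv ℝ (u t) x (a + x + A x) + u t x +
        (2 * t) • Literature.Analysis.FluidPDE.timeDeriv u t x - A (u t x) = 0 := by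
  obtain ⟨hcl, h1, hmul, hinv⟩ := stub_stabiliserClosedSubgroup u hdiff.continuousOn
  obtain ⟨c, b, R, Q, a, A, hc0, hb0, hR0, hQ0, hc, hb, hR, hQ, hskew, hsym⟩ :=
    stub_symmetryFamily stub_closedSubgroupCharacter u hcl h1 hmul hinv hloc
  exact ⟨a, A, hskew, stub_generatorOfFamily u hdiff c b R Q a A hc0 hb0 hR0 hQ0 hc hb hR hQ hsym⟩

/-- **The crux from the local scaling stabiliser of extremals** (Conjecture M as isolatedness modulo rigid motions
and time shifts). If every extremal pair `(C, u)` has, for all factors `c` near `1`, a scaling symmetry modulo a rigid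
motion and a forward time shift, then `ExtremalSpiralSymmetry` holds: attainment pins each time shift to `0`
(`timeShift_pinned`), so the rigid stabiliser covers a neighbourhood of `1`, and
`spiralGenerator_of_localRigidStabiliser` gives the generator. CONDITIONAL on the displayed hypothesis. [folklore] -/
theorem extremalSpiralSymmetry_of_localScalingStabiliser :
    (∀ (C : ℝ) (u : ℝ → EuclideanSpace ℝ (Fin 3) → EuclideanSpace ℝ (Fin 3)), 0 < C →
      (ContDiffOn ℝ (⊤ : ℕ∞) (Function.uncurry u) (Set.Iio 0 ×ˢ Set.univ) ∧
          (∀ t < 0, Literature.Analysis.FluidPDE.VectorCalculus.IsDivFree (u t)) ∧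
          (∀ s t : ℝ, s < t → t < 0 → ∀ x, u t x =
            Literature.Analysis.FluidPDE.heatFlow (u s) (t - s) x -
              ∫ τ in Set.Ioo s t, ∫ y,
                Literature.Analysis.FluidPDE.oseenKernel (t - τ) (x - y) (u τ y) (u τ y)) ∧
          Literature.Analysis.FluidPDE.HasTypeITimeDecay C u) ∧
        ‖u (-1) 0‖ = C ∧
        (∀ (C' : ℝ) (u' : ℝ → EuclideanSpace ℝ (Fin 3) → EuclideanSpace ℝ (Fin 3)),
          (ContDiffOn ℝ (⊤ : ℕ∞) (Function.uncurry u') (Set.Iio 0 ×ˢ Set.univ) ∧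
            (∀ t < 0, Literature.Analysis.FluidPDE.VectorCalculus.IsDivFree (u' t)) ∧
            (∀ s t : ℝ, s < t → t < 0 → ∀ x, u' t x =
              Literature.Analysis.FluidPDE.heatFlow (u' s) (t - s) x -
                ∫ τ in Set.Ioo s t, ∫ y,
                  Literature.Analysis.FluidPDE.oseenKernel (t - τ) (x - y) (u' τ y) (u' τ y)) ∧
            Literature.Analysis.FluidPDE.HasTypeITimeDecay C' u') →
          (∃ t < 0, ∃ x, u' t x ≠ 0) → C ≤ C') →
      ∃ δ₀ : ℝ, 0 < δ₀ ∧ ∀ c : ℝ, |c - 1| < δ₀ →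
        ∃ (δ : ℝ) (b : EuclideanSpace ℝ (Fin 3)) (R : EuclideanSpace ℝ (Fin 3) ≃ₗᵢ[ℝ] EuclideanSpace ℝ (Fin 3)),
          0 ≤ δ ∧ ∀ t < 0, ∀ x, c • u (c ^ 2 * t) (c • x) = R (u (t - δ) (R.symm (x - b)))) →
    _root_.Summit.NavierStokesRegularity.NavierStokesRegularity.Theses.ExtremalTypeIConstant.ExtremalSpiralSymmetry := by
  intro hloc C u hC hext
  obtain ⟨hcls, hnorm, hmin⟩ := hext
  have hI : Literature.Analysis.FluidPDE.HasTypeITimeDecay C u := hcls.2.2.2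
  obtain ⟨δ₀, hδ₀, hfam⟩ := hloc C u hC ⟨hcls, hnorm, hmin⟩
  -- pin every time shift: the rigid stabiliser covers `|c - 1| < min δ₀ ½`
  have hrig : ∃ δ₁ : ℝ, 0 < δ₁ ∧ ∀ c' : ℝ, |c' - 1| < δ₁ →
      ∃ (b' : EuclideanSpace ℝ (Fin 3)) (R' : EuclideanSpace ℝ (Fin 3) ≃ₗᵢ[ℝ] EuclideanSpace ℝ (Fin 3)),
        ∀ t < 0, ∀ x, c' • u (c' ^ 2 * t) (c' • x) = R' (u t (R'.symm (x - b'))) := by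
    refine ⟨min δ₀ (1 / 2), lt_min hδ₀ (by norm_num), fun c' hc' => ?_⟩
    have h1 : |c' - 1| < δ₀ := lt_of_lt_of_le hc' (min_le_left _ _)
    have h2 : |c' - 1| < 1 / 2 := lt_of_lt_of_le hc' (min_le_right _ _)
    have hc'pos : 0 < c' := by
      have := (abs_lt.1 h2).1
      linarith
    obtain ⟨δ', b', R', hδ', heq''⟩ := hfam c' h1
    have hδ'0 : δ' = 0 := timeShift_pinned hC hI hnorm hc'pos hδ' heq''
    subst hδ'0
    exact ⟨b', R', fun t ht x => by simpa only [sub_zero] using heq'' t ht x⟩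
  have hdiff : DifferentiableOn ℝ (Function.uncurry u) (Set.Iio 0 ×ˢ Set.univ) :=
    hcls.1.differentiableOn (by simp)
  exact spiralGenerator_of_localRigidStabiliser u hdiff hrig

end Summit.NavierStokesRegularity.NavierStokesRegularity.Theorems.ExtremalSpiralSymmetry.Registered

end
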